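import Mathlib.NumberTheory.Chebyshev
import Mathlib.NumberTheory.PrimeCounting
import Mathlib.Analysis.SpecialFunctions.Pow.Real
import Mathlib.MeasureTheory.Integral.IntervalIntegral.Basic
import HarnessLib

/-!
# Guth–Maynard 2026, Corollaries 1.3 and 1.4: primes in short intervals (statements) — NOT RH-BEARING: a density theorem counts zeros off the line, it never empties the strip (Barrier `LindelofBacklund`)

LABEL (cell rh-crit / corpus C4, D-0040, director-rh 2026-08-26 ruling (e)): NOT RH-BEARING;
bears_on: LADDER-RH §4 HELD row `DensityLadder` (stmt-19600). Corollaries 1.3 and 1.4 are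
theorems about PRIMES IN SHORT INTERVALS, RH-free literature; nothing in this file is worded as,
or is, progress toward RH (`Literature.Barriers.RiemannHypothesis.LindelofBacklund`: a
zero-density theorem counts zeros off the critical line, it never empties the strip).

Source of record: L. Guth, J. Maynard, *New large value estimates for Dirichlet polynomials*,
Ann. of Math. (2) 203 (2026), no. 2, 623–675 = arXiv:2405.20552 [key `GuthMaynard2026`]; read
from the held text (`lit read arxiv:2405.20552`, corpus-tex chunks p0003 = §1 and p0029 = §13.2).
As printed (p0003):

> **Corollary 1.3** (Count of primes in short intervals). Let `y ∈ [x^{17/30+ε}, x^{0.99}]`.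
> Then `π(x+y) − π(x) = y/log x + O_ε(y exp(−(log x)^{1/4}))`.
>
> **Corollary 1.4** (Count of primes in 'almost-all' short intervals). Let
> `y ∈ [X^{2/15+ε}, X^{0.99}]`. Then for all but `O(X exp(−(log x)^{1/4}))` choices of
> `x ∈ [X, 2X] ∩ ℕ` we have `π(x+y) − π(x) = y/log x + O_ε(y exp(−(log x)^{1/4}))`.

and the two `ψ`-level statements through which §13.2 (p0029) proves them ("By partial
summation, it suffices to prove corresponding results for the von Mangoldt function in place of
the prime indicator function"):

> `∑_{n ∈ [x, x+y]} Λ(n) = y + O(y (log x) sup_σ x^{σ−1} N(σ,T)) + O(y exp(−(log x)^{1/4}))`,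
> `T = x y⁻¹ exp(2 (log x)^{1/4})`, whence `= y + O_ε(y exp(−(log x)^{1/4}))`; and, with
> `δ = X^{−13/15+ε/2}`, "it suffices to show that
> `∫_X^{3X} (∑_{n ∈ [x, x+δx]} Λ(n) − δx)² dx ≪ δ² X³ exp(−3 (log X)^{1/4})`".

## Contents (STATEMENTS ONLY — this file gates the WP-C proof files; no fact is asserted here)

* `GuthMaynard2026_corollary_1_3` — Cor. 1.3 as printed (named `Prop`).
* `GuthMaynard2026_corollary_1_4` — Cor. 1.4 as printed (named `Prop`).
* `GuthMaynard2026_psiShortIntervals` — the `ψ`-form of Cor. 1.3 (§13.2, first half), with the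
  decay exponent `A` of `exp(−A (log x)^{1/4})` universally quantified (printed instance `A = 1`).
* `GuthMaynard2026_psiMeanSquareShort` — the mean-square target (eq:AlmostAllTarget side) of
  §13.2, second half, over a range of `δ` and with `A` universally quantified (printed instance
  `δ = X^{−13/15+ε/2}`, `A = 3`).
* PROVED consequences of Cor. 1.3 (as implications from the named `Prop`):
  `exists_prime_mem_Ioc_of_corollary_1_3` — primes in all intervals `(x, x + x^{17/30+ε}]`, `x`
  large; `primeGap_le_rpow_of_corollary_1_3` — `p_{n+1} − p_n ≤ p_n^{17/30+ε}` for `n` large.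

The proofs (cell rh-crit WP-C1…C4 and WP-D) live in sibling files: `ψ` short intervals from the
truncated explicit formula `Literature.NumberTheory.LFunctions.truncatedExplicitFormula_psi_holds`,
the `30/13` density theorem `Literature.NumberTheory.LFunctions.zeroDensity_thirty_thirteenths_holds`,
a near-`σ = 1` density bound of the shape `N(σ,T) ≪ T^{B(1−σ)^{3/2}} (log T)^C` (Ivić 1985,
Thm. 11.3; interface `NearOneZeroDensity` in `ZeroDensityNearOne.lean`) and the (inexplicit)
Vinogradov–Korobov zero-free region `Literature.NumberTheory.LFunctions.zeta_zeroFree_of_zeta_bound_ford`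
with `zeta_bound_ford_holds` — all theorems of the tree except the near-one density, whose
discharge is scheduled (WP-D). Until those files land, every declaration below is a bare `Prop`
used only as a hypothesis or as a proof target.

## Rendering decisions (binding for the WP-C proof files; referee: gm/AS-PRINTED-INDEX.md §2, §3 "§13")

* `π(x)` for real `x` is `Nat.primeCounting ⌊x⌋₊` (tree convention, e.g.
  `Literature/NumberTheory/Sieve/BombieriFriedlanderIwaniecPiForm.lean`), so
  `π(x+y) − π(x) = #{p prime : x < p ≤ x + y}`; `ψ` is Mathlib's `Chebyshev.psi`
  (`ψ x = ∑_{0 < n ≤ ⌊x⌋} Λ n`), so `ψ(x+y) − ψ(x) = ∑_{x < n ≤ x+y} Λ(n)` — the printed closed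
  range `n ∈ [x, x+y]` differs by at most one term `Λ(x) ≤ log x`, invisible at the printed
  precision `y exp(−(log x)^{1/4})`, `y ≥ x^{17/30}`.
* `O_ε(·)` / "for `x` large": `∀ ε > 0, ∃ C, ∃ x₀, ∀ x ≥ x₀, …`. For Cor. 1.3 this is equivalent to
  the reading "for all `x ≥ 2`" (on `[2, x₀]` the error is at most `(2 + 1/log 2)·y` and
  `exp(−(log x)^{1/4}) ≥ exp(−(log x₀)^{1/4})`, so the constant absorbs the initial range).
* `x^{0.99}` is `x ^ (99/100 : ℝ)`; `exp(−(log x)^{1/4})` is `Real.exp (-(Real.log x) ^ (1/4 : ℝ))`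
  (real power of `log x ≥ 0`).
* Cor. 1.4: the exceptional count is printed `O(X exp(−(log x)^{1/4}))` with a lower-case `x`
  that is bound inside the sentence; it is rendered with `log X` (for `x ∈ [X, 2X]` the two
  weights differ by a factor in `[e^{−1}, 1]` once `X ≥ 2`, so the readings are equivalent up to
  the implied constant). Both implied constants are allowed to depend on `ε` (the statement is
  made for a fixed `ε`; in §13.2 both visibly depend on it). `[X, 2X] ∩ ℕ` is
  `Finset.Icc ⌈X⌉₊ ⌊2X⌋₊`.
* The two `ψ`-interfaces quantify the decay exponent `A` universally: §13.2 proves them for every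
  fixed `A` by taking `T = x y⁻¹ exp((A+1)(log x)^{1/4})` (resp. `T = δ⁻¹ exp((A+1)(log X)^{1/4})`)
  in place of the printed `2` (resp. `4`) — the saving produced by the Vinogradov–Korobov region,
  `exp(−c ε (log x)^{1/3}(log log x)^{−1/3})`, beats every `exp(−A (log x)^{1/4})`. Consumers
  (Cor. 1.3, Cor. 1.4) need `A = 1` and `A = 3` respectively.

## References

* [GuthMaynard2026] L. Guth, J. Maynard, *New large value estimates for Dirichlet polynomials*,
  Ann. of Math. (2) 203 (2026), no. 2, 623–675; arXiv:2405.20552. Cor. 1.3, Cor. 1.4 (§1, p. 3 of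
  the held text = chunk p0003), §13.2 (proofs; chunk p0029).
* M. N. Huxley, *On the difference between consecutive primes*, Invent. Math. 15 (1972) 164–170
  (the previous exponents `7/12` and `1/6`, quoted loc. cit.).
-/

noncomputable section

open Real MeasureTheory
open scoped Chebyshev

namespace Literature.NumberTheory.LFunctions

/-! ## Corollaries 1.3 and 1.4 as printed -/

/-- **Guth–Maynard 2026, Corollary 1.3 (count of primes in short intervals)**, as printed:
*Let `y ∈ [x^{17/30+ε}, x^{0.99}]`. Then `π(x+y) − π(x) = y/log x + O_ε(y exp(−(log x)^{1/4}))`.*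
Rendered: for every `ε > 0` there are `C` and `x₀` such that for all real `x ≥ x₀` and all real
`y` with `x^{17/30+ε} ≤ y ≤ x^{0.99}`,
`|π(x+y) − π(x) − y/log x| ≤ C · y · exp(−(log x)^{1/4})`, where `π(u) = Nat.primeCounting ⌊u⌋₊`.
A theorem in print (RH-free; about primes, not about RH); proved in the tree from
`GuthMaynard2026_psiShortIntervals` by partial summation (sibling WP-C files), not in this file.
[cite: GuthMaynard2026, Corollary 1.3 (§1; proof §13.2)] -/
def GuthMaynard2026_corollary_1_3 : Prop :=
  ∀ ε : ℝ, 0 < ε → ∃ C x₀ : ℝ, ∀ x : ℝ, x₀ ≤ x → ∀ y : ℝ,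
    x ^ (17 / 30 + ε) ≤ y → y ≤ x ^ (99 / 100 : ℝ) →
      |(Nat.primeCounting ⌊x + y⌋₊ : ℝ) - (Nat.primeCounting ⌊x⌋₊ : ℝ) - y / Real.log x|
        ≤ C * y * Real.exp (-(Real.log x) ^ (1 / 4 : ℝ))

/-- **Guth–Maynard 2026, Corollary 1.4 (count of primes in 'almost-all' short intervals)**, as
printed: *Let `y ∈ [X^{2/15+ε}, X^{0.99}]`. Then for all but `O(X exp(−(log x)^{1/4}))` choices of
`x ∈ [X, 2X] ∩ ℕ` we have `π(x+y) − π(x) = y/log x + O_ε(y exp(−(log x)^{1/4}))`.*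
Rendered: for every `ε > 0` there are `C`, `K` and `X₀` such that for all real `X ≥ X₀` and all
real `y` with `X^{2/15+ε} ≤ y ≤ X^{0.99}`, the number of integers `x ∈ [X, 2X]` with
`|π(x+y) − π(x) − y/log x| > C · y · exp(−(log x)^{1/4})` is at most `K · X · exp(−(log X)^{1/4})`
(`π(u) = Nat.primeCounting ⌊u⌋₊`; the printed `log x` inside the exceptional count, where `x` is
bound, is read `log X` — equivalent up to the constant `K`, see the module docstring).
A theorem in print (RH-free); proved in the tree from `GuthMaynard2026_psiMeanSquareShort`
(sibling WP-C files), not in this file.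
[cite: GuthMaynard2026, Corollary 1.4 (§1; proof §13.2)] -/
def GuthMaynard2026_corollary_1_4 : Prop :=
  ∀ ε : ℝ, 0 < ε → ∃ C K X₀ : ℝ, ∀ X : ℝ, X₀ ≤ X → ∀ y : ℝ,
    X ^ (2 / 15 + ε) ≤ y → y ≤ X ^ (99 / 100 : ℝ) →
      (((Finset.Icc ⌈X⌉₊ ⌊2 * X⌋₊).filter fun x : ℕ =>
          C * y * Real.exp (-(Real.log x) ^ (1 / 4 : ℝ)) <
            |(Nat.primeCounting ⌊(x : ℝ) + y⌋₊ : ℝ) - (Nat.primeCounting x : ℝ)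
              - y / Real.log x|).card : ℝ)
        ≤ K * X * Real.exp (-(Real.log X) ^ (1 / 4 : ℝ))

/-! ## The `ψ`-level statements of §13.2 (interfaces for the proof files) -/

/-- **`ψ` in all short intervals `[x, x + y]`, `y ≥ x^{17/30+ε}`** — the von Mangoldt form of
Corollary 1.3 established in §13.2 (first half: explicit formula with
`T = x y⁻¹ exp(2 (log x)^{1/4})`, the bound `N(σ,T) ≪ T^{(30/13+o(1))(1−σ)} (log T)^{O(1)}` and
the Vinogradov–Korobov zero-free region): for every `ε > 0` and every `A` there are `C`, `x₀`
with `|ψ(x+y) − ψ(x) − y| ≤ C · y · exp(−A (log x)^{1/4})` for all `x ≥ x₀` and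
`x^{17/30+ε} ≤ y ≤ x^{0.99}` (`ψ = Chebyshev.psi`). The printed instance is `A = 1`; every
fixed `A` follows from the same argument with `T = x y⁻¹ exp((A+1)(log x)^{1/4})`. Interface
(proof target of WP-C1, hypothesis of WP-C2); not asserted here.
[cite: GuthMaynard2026, §13.2, proof of Corollary 1.3 (displays 1–2 and the conclusion)] -/
def GuthMaynard2026_psiShortIntervals : Prop :=
  ∀ ε : ℝ, 0 < ε → ∀ A : ℝ, ∃ C x₀ : ℝ, ∀ x : ℝ, x₀ ≤ x → ∀ y : ℝ,
    x ^ (17 / 30 + ε) ≤ y → y ≤ x ^ (99 / 100 : ℝ) →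
      |ψ (x + y) - ψ x - y| ≤ C * y * Real.exp (-A * (Real.log x) ^ (1 / 4 : ℝ))

/-- **Mean square of `ψ` in short intervals `[x, x + δx]`, `δ ≥ X^{−13/15+ε}`** — the target
(eq:AlmostAllTarget) side of §13.2, second half ("it suffices to show that
`∫_X^{3X} (∑_{n∈[x,x+δx]} Λ(n) − δx)² dx ≪ δ² X³ exp(−3 (log X)^{1/4})`", there with
`δ = X^{−13/15+ε/2}` and `T = δ⁻¹ exp(4 (log X)^{1/4})`): for every `ε > 0` and every `A` there are
`C`, `X₀` with `∫_X^{3X} (ψ(x + δx) − ψ(x) − δx)² dx ≤ C · δ² · X³ · exp(−A (log X)^{1/4})` for all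
`X ≥ X₀` and `X^{−13/15+ε} ≤ δ ≤ X^{−1/100}` (`ψ = Chebyshev.psi`; the printed closed range
`[x, x+δx]` and `(x, x+δx]` agree for a.e. `x`). Every fixed `A` follows from the printed argument
with `T = δ⁻¹ exp((A+1)(log X)^{1/4})`. Interface (proof target of WP-C3, hypothesis of WP-C4);
not asserted here. [cite: GuthMaynard2026, §13.2, proof of Corollary 1.4 (eq. AlmostAllTarget)] -/
def GuthMaynard2026_psiMeanSquareShort : Prop :=
  ∀ ε : ℝ, 0 < ε → ∀ A : ℝ, ∃ C X₀ : ℝ, ∀ X : ℝ, X₀ ≤ X → ∀ δ : ℝ,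
    X ^ (-(13 / 15 : ℝ) + ε) ≤ δ → δ ≤ X ^ (-(1 / 100 : ℝ)) →
      ∫ x in X..(3 * X), (ψ (x + δ * x) - ψ x - δ * x) ^ 2
        ≤ C * δ ^ 2 * X ^ 3 * Real.exp (-A * (Real.log X) ^ (1 / 4 : ℝ))

/-! ## Consequences of Corollary 1.3 (proved): primes in all short intervals, prime gaps -/

/-- If `π(n) < π(m)` there is a prime in `(n, m]`. [folklore] -/
private theorem exists_prime_of_primeCounting_lt {n m : ℕ}
    (h : Nat.primeCounting n < Nat.primeCounting m) : ∃ p : ℕ, p.Prime ∧ n < p ∧ p ≤ m := by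
  by_contra hne
  simp only [not_exists, not_and, not_le] at hne
  have hsub : Nat.primesLE m ⊆ Nat.primesLE n := by
    intro p hp
    rw [Nat.mem_primesLE] at hp ⊢
    refine ⟨?_, hp.2⟩
    by_contra hpn
    rw [not_le] at hpn
    exact absurd hp.1 (not_le.2 (hne p hp.2 hpn))
  have := Finset.card_le_card hsub
  rw [Nat.primesLE_card_eq_primeCounting, Nat.primesLE_card_eq_primeCounting] at this
  omega

/-- `C · log x · exp(−(log x)^{1/4}) < 1` for `x` large. [folklore] -/
private theorem exists_mul_log_mul_exp_lt_one (C : ℝ) :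
    ∃ X₁ : ℝ, 1 < X₁ ∧ ∀ x : ℝ, X₁ ≤ x →
      C * Real.log x * Real.exp (-(Real.log x) ^ (1 / 4 : ℝ)) < 1 := by
  obtain ⟨u₀, hu₀⟩ : ∃ u₀ : ℝ, u₀ = 120 * |C| + 1 := ⟨_, rfl⟩
  have hu₀1 : 1 ≤ u₀ := by have := abs_nonneg C; rw [hu₀]; linarith
  refine ⟨Real.exp (u₀ ^ 4), ?_, fun x hx => ?_⟩
  · have : (0 : ℝ) < u₀ ^ 4 := by positivity
    calc (1 : ℝ) = Real.exp 0 := (Real.exp_zero).symm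
      _ < Real.exp (u₀ ^ 4) := Real.exp_lt_exp.2 this
  have hx0 : 0 < x := lt_of_lt_of_le (Real.exp_pos _) hx
  obtain ⟨L, hL⟩ : ∃ L : ℝ, L = Real.log x := ⟨_, rfl⟩
  rw [← hL]
  have hLu : u₀ ^ 4 ≤ L := by
    rw [hL, ← Real.log_exp (u₀ ^ 4)]; exact Real.log_le_log (Real.exp_pos _) hx
  have hL1 : 1 ≤ L := le_trans (one_le_pow₀ hu₀1) hLu
  have hL0 : 0 < L := by linarith
  obtain ⟨u, hu⟩ : ∃ u : ℝ, u = L ^ (1 / 4 : ℝ) := ⟨_, rfl⟩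
  rw [← hu]
  have hu1 : 1 ≤ u := by rw [hu]; exact Real.one_le_rpow hL1 (by norm_num)
  have hupos : 0 < u := by linarith
  have huL : u ^ 4 = L := by
    rw [hu, ← Real.rpow_natCast, ← Real.rpow_mul hL0.le]; norm_num
  have hu₀u : u₀ ≤ u := by
    by_contra h'
    rw [not_le] at h'
    have : u ^ 4 < u₀ ^ 4 := pow_lt_pow_left₀ h' (by linarith) (by norm_num)
    linarith
  -- `exp u ≥ u^5 / 120 > |C| u^4 = |C| L`
  have hexp : u ^ 5 / 120 ≤ Real.exp u := by
    have := Real.pow_div_factorial_le_exp u hupos.le 5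
    simpa [Nat.factorial] using this
  have hCu : |C| * L < u ^ 5 / 120 := by
    rw [← huL]
    have h1 : 120 * |C| < u := by linarith
    have h2 : u ^ 5 = u * u ^ 4 := by ring
    rw [h2]
    have hu4 : 0 < u ^ 4 := by positivity
    nlinarith
  have hexp0 : 0 < Real.exp u := Real.exp_pos u
  have hCL : C * L ≤ |C| * L := mul_le_mul_of_nonneg_right (le_abs_self C) hL0.le
  rw [Real.exp_neg]
  rw [show C * L * (Real.exp u)⁻¹ = C * L / Real.exp u by ring, div_lt_one hexp0]
  linarith

/-- **Primes in all short intervals `(x, x + x^{17/30+ε}]`** from Corollary 1.3: for every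
`ε > 0` and all large `x` there is a prime `p` with `x < p ≤ x + x^{17/30+ε}` (the statement
listed as "Guth–Maynard `17/30 + ε` — not reproduced" in
`Literature/NumberTheory/Sieve/HoheiselPrimesShortIntervals.lean`). Proof: Cor. 1.3 with
`y = x^{17/30+ε'}`, `ε' = min ε (1/4)`, gives `π(x+y) − π(x) ≥ y/log x − C y e^{−(log x)^{1/4}} > 0`
once `C log x < e^{(log x)^{1/4}}`. [cite: GuthMaynard2026, Corollary 1.3] -/
theorem exists_prime_mem_Ioc_of_corollary_1_3 (h : GuthMaynard2026_corollary_1_3) {ε : ℝ}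
    (hε : 0 < ε) :
    ∃ x₀ : ℝ, ∀ x : ℝ, x₀ ≤ x → ∃ p : ℕ, p.Prime ∧ x < p ∧ (p : ℝ) ≤ x + x ^ (17 / 30 + ε) := by
  obtain ⟨ε', hε'⟩ : ∃ ε' : ℝ, ε' = min ε (1 / 4) := ⟨_, rfl⟩
  have hε'0 : 0 < ε' := by rw [hε']; exact lt_min hε (by norm_num)
  have hε'ε : ε' ≤ ε := by rw [hε']; exact min_le_left _ _
  have hε'4 : ε' ≤ 1 / 4 := by rw [hε']; exact min_le_right _ _
  obtain ⟨C, x₀, hC⟩ := h ε' hε'0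
  obtain ⟨X₁, hX₁, hX⟩ := exists_mul_log_mul_exp_lt_one C
  refine ⟨max x₀ X₁, fun x hx => ?_⟩
  have hxx₀ : x₀ ≤ x := (le_max_left _ _).trans hx
  have hxX₁ : X₁ ≤ x := (le_max_right _ _).trans hx
  have hx1 : 1 < x := lt_of_lt_of_le hX₁ hxX₁
  have hx0 : 0 < x := by linarith
  have hlog0 : 0 < Real.log x := Real.log_pos hx1
  obtain ⟨y, hy⟩ : ∃ y : ℝ, y = x ^ (17 / 30 + ε') := ⟨_, rfl⟩
  have hy0 : 0 < y := by rw [hy]; exact Real.rpow_pos_of_pos hx0 _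
  have hy1 : x ^ (17 / 30 + ε') ≤ y := by rw [hy]
  have hy2 : y ≤ x ^ (99 / 100 : ℝ) := by
    rw [hy]; exact Real.rpow_le_rpow_of_exponent_le hx1.le (by linarith)
  have hyε : y ≤ x ^ (17 / 30 + ε) := by
    rw [hy]; exact Real.rpow_le_rpow_of_exponent_le hx1.le (by linarith)
  have hmain := hC x hxx₀ y hy1 hy2
  have hsmall := hX x hxX₁
  -- `π(x+y) − π(x) ≥ y/log x − C y e^{−(log x)^{1/4}} > 0`
  have hpos : (0 : ℝ) < (Nat.primeCounting ⌊x + y⌋₊ : ℝ) - (Nat.primeCounting ⌊x⌋₊ : ℝ) := by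
    have h1 := (abs_le.1 hmain).1
    -- `C y e^{-u} < y / log x`
    have h2 : C * y * Real.exp (-(Real.log x) ^ (1 / 4 : ℝ)) < y / Real.log x := by
      rw [lt_div_iff₀ hlog0]
      have := mul_lt_mul_of_pos_left hsmall hy0
      calc C * y * Real.exp (-(Real.log x) ^ (1 / 4 : ℝ)) * Real.log x
          = y * (C * Real.log x * Real.exp (-(Real.log x) ^ (1 / 4 : ℝ))) := by ring
        _ < y * 1 := this
        _ = y := mul_one y
    linarith
  have hlt : Nat.primeCounting ⌊x⌋₊ < Nat.primeCounting ⌊x + y⌋₊ := by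
    have : (Nat.primeCounting ⌊x⌋₊ : ℝ) < (Nat.primeCounting ⌊x + y⌋₊ : ℝ) := by linarith
    exact_mod_cast this
  obtain ⟨p, hp, hxp, hpy⟩ := exists_prime_of_primeCounting_lt hlt
  refine ⟨p, hp, Nat.lt_of_floor_lt hxp, ?_⟩
  calc (p : ℝ) ≤ (⌊x + y⌋₊ : ℝ) := by exact_mod_cast hpy
    _ ≤ x + y := Nat.floor_le (by linarith)
    _ ≤ x + x ^ (17 / 30 + ε) := by linarith

/-- **Prime gaps `p_{n+1} − p_n ≤ p_n^{17/30+ε}`** for all large `n`, from Corollary 1.3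
(`p_n = Nat.nth Nat.Prime n`; apply `exists_prime_mem_Ioc_of_corollary_1_3` at `x = p_n`).
[cite: GuthMaynard2026, Corollary 1.3] -/
theorem primeGap_le_rpow_of_corollary_1_3 (h : GuthMaynard2026_corollary_1_3) {ε : ℝ}
    (hε : 0 < ε) :
    ∃ n₀ : ℕ, ∀ n : ℕ, n₀ ≤ n →
      (Nat.nth Nat.Prime (n + 1) : ℝ) - (Nat.nth Nat.Prime n : ℝ) ≤
        (Nat.nth Nat.Prime n : ℝ) ^ (17 / 30 + ε) := by
  obtain ⟨x₀, hx₀⟩ := exists_prime_mem_Ioc_of_corollary_1_3 h hε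
  have hinf : (setOf Nat.Prime).Infinite := Nat.infinite_setOf_prime
  refine ⟨⌈x₀⌉₊, fun n hn => ?_⟩
  have hpn : x₀ ≤ (Nat.nth Nat.Prime n : ℝ) := by
    have h1 : n ≤ Nat.nth Nat.Prime n := (Nat.nth_strictMono hinf).id_le n
    have h2 : (⌈x₀⌉₊ : ℝ) ≤ (Nat.nth Nat.Prime n : ℝ) := by exact_mod_cast hn.trans h1
    exact (Nat.le_ceil _).trans h2
  obtain ⟨p, hp, hlt, hle⟩ := hx₀ _ hpn
  have hlt' : Nat.nth Nat.Prime n < p := by exact_mod_cast hlt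
  -- `p_{n+1} ≤ p`
  have hnext : Nat.nth Nat.Prime (n + 1) ≤ p := by
    have hc : n + 1 ≤ Nat.count Nat.Prime p := by
      have := Nat.count_monotone Nat.Prime (Nat.succ_le_of_lt hlt')
      rwa [Nat.count_nth_succ_of_infinite hinf n] at this
    calc Nat.nth Nat.Prime (n + 1) ≤ Nat.nth Nat.Prime (Nat.count Nat.Prime p) :=
          Nat.nth_monotone hinf hc
      _ = p := Nat.nth_count hp
  have : (Nat.nth Nat.Prime (n + 1) : ℝ) ≤ p := by exact_mod_cast hnext
  linarith

end Literature.NumberTheory.LFunctions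

end
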